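import Summits.CriticalPhenomena.PercolationContinuityZ3.Theorems.Transplant.DiamondLattice
import Mathlib.Tactic.FinCases
import Mathlib.Tactic.Ring
import Mathlib.Tactic.Linarith
import HarnessLib

/-!
# The DIAMOND lattice (class C1b, row F), II: the induced skeleton cylinders `diamondSkel⁻¹(Λ_ℓ)` are connected (tetrahedral descent on
# `|x|²`), hence the diamond lattice is connected

builds on p205010 (kernel theorem, internal audit signed; external expert review pending).
Status sentence (coordinator 2026-08-20T04:30Z): "θ(p_c) = 0 on ℤ^d, all d ≥ 2 — kernel-verified (Lean 4/Mathlib,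
standard axioms); internal adversarial audit SIGNED 2026-08-20 04:29Z; external expert review pending."

Lane `prim-bschramm-*`, seat `prim-bschramm-p2` (gen 6).  Input (κ) of the lane's interface `PlanarSkeletonConc` for the diamond lattice of
`DiamondLattice.lean`: the subgraph induced on the cylinder `diamondCyl ℓ = {x : diamondSkel x ∈ Λ_ℓ}` (`= {|x₀+x₁| ≤ 2ℓ, |x₀−x₁| ≤ 2ℓ}`) is
connected for every `ℓ ≥ 1`.  Unlike bcc (`BccSkeletonConc.lean`: all eight sign directions are bonds, so the coordinatewise descent works),
a diamond site has only FOUR bonds `d`, one per skeleton direction; the descent uses the TETRAHEDRAL identity instead: the four inner products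
`⟨x, d⟩` sum to `0`, are all `≡ 0 (mod 4)` at an even site and all `≡ 1 (mod 4)` at an odd site (`x₀ ≡ x₁ ≡ x₂ (mod 2)`,
`x₀+x₁+x₂ ≡ 0, 3 (mod 4)`), so at `x ≠ 0` the least of them is `≤ -2` and the bond `d` realising it has `|x + d|² = |x|² + 2⟨x,d⟩ + 3 < |x|²`;
moreover the bond of LEAST inner product points towards the axis of the cylinder in the skeleton (`⟨x, d_E⟩ − ⟨x, d_W⟩ = 4 φ₀(x)`,
`⟨x, d_N⟩ − ⟨x, d_S⟩ = 4 φ₁(x)`), so it stays inside `diamondCyl ℓ` once `ℓ ≥ 1`.  Strong induction on `|x|²` joins every cylinder vertex to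
the origin inside the cylinder (`diamondCyl_reachable_origin`, `diamondCylGraph_connected`), and `diamondGraph_connected` follows.
[cite: ConwaySloane1999, Ch. 4 §7.3 (D₃⁺ = diamond)] [cite: KozmaNitzan2024, §4 p. 17 (sub-boxes / cylinders)]
-/

noncomputable section

namespace Summit.CriticalPhenomena.PercolationContinuityZ3.Theorems.Transplant

open MeasureTheory Literature.Probability.Percolation Literature.Probability.LatticeModels SimpleGraph
open BccConc (normSq eq_zero_of_normSq_le_zero)

/-! ## §1 The cylinders `diamondSkel⁻¹(Λ_ℓ)` -/

/-- The diamond cylinder of half-width `ℓ`: the preimage `diamondSkel⁻¹(Λ_ℓ)` of the skeleton box. [cite: KozmaNitzan2024, §4 p. 25] -/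
def diamondCyl (ℓ : ℕ) : Set diamondSite := {x | diamondSkel x ∈ box 2 ℓ}

/-- Membership in the diamond cylinder. [folklore] -/
theorem mem_diamondCyl_iff {ℓ : ℕ} {x : diamondSite} : x ∈ diamondCyl ℓ ↔ diamondSkel x ∈ box 2 ℓ := Iff.rfl

/-- In the diamond cylinder the first two ambient coordinates are bounded by `2ℓ`. [folklore] -/
theorem abs_le_of_mem_diamondCyl {ℓ : ℕ} {x : diamondSite} (hx : x ∈ diamondCyl ℓ) :
    |(x : Site 3) 0| ≤ (2 * ℓ : ℕ) ∧ |(x : Site 3) 1| ≤ (2 * ℓ : ℕ) :=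
  abs_le_of_mem_bccCyl (x := toBcc x) hx

/-- The origin lies in every diamond cylinder. [folklore] -/
theorem diamondOrigin_mem_diamondCyl (ℓ : ℕ) : diamondOrigin ∈ diamondCyl ℓ := by
  simp only [diamondCyl, Set.mem_setOf_eq, diamondSkel_origin, mem_box, Pi.zero_apply]
  intro i; omega

/-- The diamond cylinder graph: the subgraph of `diamondGraph` induced on `diamondSkel⁻¹(Λ_ℓ)`. [cite: KozmaNitzan2024, §4 p. 25] -/
abbrev diamondCylGraph (ℓ : ℕ) : SimpleGraph (diamondCyl ℓ) := diamondGraph.induce (diamondCyl ℓ)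

/-! ## §2 The tetrahedral descent -/

/-- The Euclidean inner product on `ℤ³`. [folklore] -/
def ip (x d : Site 3) : ℤ := x 0 * d 0 + x 1 * d 1 + x 2 * d 2

/-- `|x + d|² = |x|² + 2⟨x,d⟩ + 3` for a vector `d` with coordinates `±1`. [folklore] -/
theorem normSq_add_unit (x d : Site 3) (hd : ∀ j, d j = 1 ∨ d j = -1) : normSq (x + d) = normSq x + 2 * ip x d + 3 := by
  have hsq : ∀ j, d j ^ 2 = 1 := fun j => by rcases hd j with h | h <;> rw [h] <;> norm_num
  unfold normSq ip
  simp only [Pi.add_apply]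
  linear_combination hsq 0 + hsq 1 + hsq 2

/-- The inner product with an east/west bond: `⟨x, (σ,σ,κ)⟩ = σ(x₀+x₁) + κ x₂`. [folklore] -/
theorem ip_bondVec_zero (x : Site 3) (σ : ℤ) : ip x (bondVec x 0 σ) = σ * (x 0 + x 1) + fibreSign x * x 2 := by
  unfold ip
  rw [bondVec_zero, bondVec_one, bondVec_two, if_pos rfl, if_pos rfl]
  ring

/-- The inner product with a north/south bond: `⟨x, (σ,-σ,-κ)⟩ = σ(x₀−x₁) − κ x₂`. [folklore] -/
theorem ip_bondVec_one (x : Site 3) (σ : ℤ) : ip x (bondVec x 1 σ) = σ * (x 0 - x 1) - fibreSign x * x 2 := by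
  unfold ip
  rw [bondVec_zero, bondVec_one, bondVec_two, if_neg (show (1 : Fin 2) ≠ 0 by decide),
    if_neg (show (1 : Fin 2) ≠ 0 by decide)]
  ring

/-- A skeleton step that keeps the moved coordinate in `[-ℓ, ℓ]` stays in the box `Λ_ℓ`. [folklore] -/
theorem skel_step_mem_box {ℓ : ℕ} {t : Site 2} (ht : t ∈ box 2 ℓ) (i : Fin 2) (σ : ℤ)
    (h : -(ℓ : ℤ) ≤ t i + σ ∧ t i + σ ≤ ℓ) : t + Pi.single i σ ∈ box 2 ℓ := by
  rw [mem_box] at ht ⊢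
  intro j
  rw [Pi.add_apply]
  by_cases hj : j = i
  · subst hj; rw [Pi.single_eq_same]; exact h
  · rw [Pi.single_eq_of_ne hj, add_zero]; exact ht j

/-- **The tetrahedral identity at an EVEN site**: the four inner products `x₀+x₁+x₂`, `−x₀−x₁+x₂`, `x₀−x₁−x₂`, `−x₀+x₁−x₂` with the bonds
sum to `0` and are `≡ 0 (mod 4)`, so at `x ≠ 0` the least is `≤ -2` (indeed `≤ -4`). [folklore] -/
theorem tetra_min_even (x0 x1 x2 : ℤ) (h0 : x0 % 2 = 0) (h1 : x1 % 2 = 0) (h2 : x2 % 2 = 0)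
    (hs : (x0 + x1 + x2) % 4 = 0) (hne : ¬ (x0 = 0 ∧ x1 = 0 ∧ x2 = 0)) :
    min (min (x0 + x1 + x2) (-(x0 + x1) + x2)) (min (x0 - x1 - x2) (-(x0 - x1) - x2)) ≤ -2 := by
  omega

/-- **The tetrahedral identity at an ODD site**: the four inner products `x₀+x₁−x₂`, `−x₀−x₁−x₂`, `x₀−x₁+x₂`, `−x₀+x₁+x₂` sum to `0` and are
`≡ 1 (mod 4)`, so the least is `≤ -3`. [folklore] -/
theorem tetra_min_odd (x0 x1 x2 : ℤ) (h0 : x0 % 2 = 1) (h1 : x1 % 2 = 1) (h2 : x2 % 2 = 1)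
    (hs : (x0 + x1 + x2) % 4 = 3) :
    min (min (x0 + x1 - x2) (-(x0 + x1) - x2)) (min (x0 - x1 + x2) (-(x0 - x1) + x2)) ≤ -2 := by
  omega

/-- **DESCENT**: every non-zero vertex of the cylinder `diamondSkel⁻¹(Λ_ℓ)`, `ℓ ≥ 1`, has a cylinder neighbour of smaller `|x|²` — the bond
of least inner product, which points towards the axis of the cylinder (`⟨x,d_E⟩ − ⟨x,d_W⟩ = 4φ₀(x)`, `⟨x,d_N⟩ − ⟨x,d_S⟩ = 4φ₁(x)`).
[cite: ConwaySloane1999, Ch. 4 §7.3] -/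
theorem diamondCyl_descent {ℓ : ℕ} (hℓ : 1 ≤ ℓ) {x : diamondSite} (hx : x ∈ diamondCyl ℓ) (h0 : (x : Site 3) ≠ 0) :
    ∃ y : diamondSite, ∃ hy : y ∈ diamondCyl ℓ,
      (diamondCylGraph ℓ).Adj ⟨x, hx⟩ ⟨y, hy⟩ ∧ normSq (y : Site 3) < normSq (x : Site 3) := by
  obtain ⟨hp0, hp1, hp2⟩ := x.2
  have hu := two_mul_diamondSkel_zero x
  have hv := two_mul_diamondSkel_one x
  have hbox : (-(ℓ : ℤ) ≤ diamondSkel x 0 ∧ diamondSkel x 0 ≤ ℓ) ∧ (-(ℓ : ℤ) ≤ diamondSkel x 1 ∧ diamondSkel x 1 ≤ ℓ) := by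
    have h := hx
    simp only [diamondCyl, Set.mem_setOf_eq, mem_box, Fin.forall_fin_two] at h
    exact h
  have hne : ¬ ((x : Site 3) 0 = 0 ∧ (x : Site 3) 1 = 0 ∧ (x : Site 3) 2 = 0) := by
    intro h
    apply h0
    ext j
    rcases (show j = 0 ∨ j = 1 ∨ j = 2 by fin_cases j <;> simp) with rfl | rfl | rfl
    · exact h.1
    · exact h.2.1
    · exact h.2.2
  -- the fibre term `A = κ x₂` and the tetrahedral bound on the least inner product
  set A : ℤ := fibreSign (x : Site 3) * (x : Site 3) 2 with hA
  have hmin : min (min (((x : Site 3) 0 + (x : Site 3) 1) + A) (-((x : Site 3) 0 + (x : Site 3) 1) + A))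
      (min (((x : Site 3) 0 - (x : Site 3) 1) - A) (-((x : Site 3) 0 - (x : Site 3) 1) - A)) ≤ -2 := by
    rcases Int.emod_two_eq_zero_or_one ((x : Site 3) 2) with h2 | h2
    · have hAe : A = (x : Site 3) 2 := by rw [hA]; unfold fibreSign; rw [h2]; ring
      rw [hAe]
      exact tetra_min_even ((x : Site 3) 0) ((x : Site 3) 1) ((x : Site 3) 2) (by omega) (by omega) h2 (by omega) hne
    · have hAo : A = -(x : Site 3) 2 := by rw [hA]; unfold fibreSign; rw [h2]; ring
      rw [hAo]
      have h := tetra_min_odd ((x : Site 3) 0) ((x : Site 3) 1) ((x : Site 3) 2) (by omega) (by omega) h2 (by omega)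
      convert h using 3 <;> ring
  -- the four inner products
  have vE : ip (x : Site 3) (bondVec x 0 1) = ((x : Site 3) 0 + (x : Site 3) 1) + A := by rw [ip_bondVec_zero]; ring
  have vW : ip (x : Site 3) (bondVec x 0 (-1)) = -((x : Site 3) 0 + (x : Site 3) 1) + A := by rw [ip_bondVec_zero]; ring
  have vN : ip (x : Site 3) (bondVec x 1 1) = ((x : Site 3) 0 - (x : Site 3) 1) - A := by rw [ip_bondVec_one]; ring
  have vS : ip (x : Site 3) (bondVec x 1 (-1)) = -((x : Site 3) 0 - (x : Site 3) 1) - A := by rw [ip_bondVec_one]; ring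
  -- the generic witness: a bond that stays in the box and decreases `|x|²`
  have build : ∀ (i : Fin 2) (σ : ℤ) (hσ : σ = 1 ∨ σ = -1),
      diamondSkel x + Pi.single i σ ∈ box 2 ℓ → 2 * ip (x : Site 3) (bondVec x i σ) + 3 < 0 →
      ∃ y : diamondSite, ∃ hy : y ∈ diamondCyl ℓ,
        (diamondCylGraph ℓ).Adj ⟨x, hx⟩ ⟨y, hy⟩ ∧ normSq (y : Site 3) < normSq (x : Site 3) := by
    intro i σ hσ hb hd
    refine ⟨bondEnd x i hσ, ?_, diamondGraph_adj_bondEnd x i hσ, ?_⟩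
    · show diamondSkel (bondEnd x i hσ) ∈ box 2 ℓ
      rw [diamondSkel_bondEnd]; exact hb
    · rw [coe_bondEnd, normSq_add_unit _ _ (bondVec_unit x i hσ)]
      linarith
  -- steering: the smaller of E/W (resp. N/S) points towards the axis, hence stays in the box
  by_cases hu0 : diamondSkel x 0 ≤ 0
  · by_cases hEv : 2 * (((x : Site 3) 0 + (x : Site 3) 1) + A) + 3 < 0
    · exact build 0 1 (Or.inl rfl) (skel_step_mem_box hx 0 1 (by omega)) (by rw [vE]; exact hEv)
    · by_cases hv0 : diamondSkel x 1 ≤ 0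
      · have hNv : 2 * (((x : Site 3) 0 - (x : Site 3) 1) - A) + 3 < 0 := by omega
        exact build 1 1 (Or.inl rfl) (skel_step_mem_box hx 1 1 (by omega)) (by rw [vN]; exact hNv)
      · have hSv : 2 * (-((x : Site 3) 0 - (x : Site 3) 1) - A) + 3 < 0 := by omega
        exact build 1 (-1) (Or.inr rfl) (skel_step_mem_box hx 1 (-1) (by omega)) (by rw [vS]; exact hSv)
  · by_cases hWv : 2 * (-((x : Site 3) 0 + (x : Site 3) 1) + A) + 3 < 0
    · exact build 0 (-1) (Or.inr rfl) (skel_step_mem_box hx 0 (-1) (by omega)) (by rw [vW]; exact hWv)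
    · by_cases hv0 : diamondSkel x 1 ≤ 0
      · have hNv : 2 * (((x : Site 3) 0 - (x : Site 3) 1) - A) + 3 < 0 := by omega
        exact build 1 1 (Or.inl rfl) (skel_step_mem_box hx 1 1 (by omega)) (by rw [vN]; exact hNv)
      · have hSv : 2 * (-((x : Site 3) 0 - (x : Site 3) 1) - A) + 3 < 0 := by omega
        exact build 1 (-1) (Or.inr rfl) (skel_step_mem_box hx 1 (-1) (by omega)) (by rw [vS]; exact hSv)

/-! ## §3 Reachability inside the cylinder and connectedness -/

/-- **Every cylinder vertex is joined to the origin inside the cylinder** (`ℓ ≥ 1`; strong induction on `|x|²`). [folklore] -/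
theorem diamondCyl_reachable_origin {ℓ : ℕ} (hℓ : 1 ≤ ℓ) :
    ∀ (n : ℕ) (x : diamondSite) (hx : x ∈ diamondCyl ℓ), normSq (x : Site 3) ≤ n →
      (diamondCylGraph ℓ).Reachable ⟨x, hx⟩ ⟨diamondOrigin, diamondOrigin_mem_diamondCyl ℓ⟩ := by
  intro n
  induction n with
  | zero =>
    intro x hx hn
    have hx0 : (x : Site 3) = 0 := eq_zero_of_normSq_le_zero (by exact_mod_cast hn)
    have : x = diamondOrigin := Subtype.ext hx0
    subst this
    rfl
  | succ n ih =>
    intro x hx hn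
    by_cases hx0 : (x : Site 3) = 0
    · have : x = diamondOrigin := Subtype.ext hx0
      subst this
      rfl
    · obtain ⟨y, hy, hadj, hlt⟩ := diamondCyl_descent hℓ hx hx0
      have hyn : normSq (y : Site 3) ≤ n := by
        have : normSq (y : Site 3) < (n : ℤ) + 1 := lt_of_lt_of_le hlt (by exact_mod_cast hn)
        omega
      exact hadj.reachable.trans (ih y hy hyn)

/-- **(κ) the induced diamond cylinder `diamondSkel⁻¹(Λ_ℓ)` is connected for `ℓ ≥ 1`.** [cite: KozmaNitzan2024, §4 p. 17 (subboxes)] -/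
theorem diamondCylGraph_connected {ℓ : ℕ} (hℓ : 1 ≤ ℓ) : (diamondCylGraph ℓ).Connected := by
  haveI : Nonempty (diamondCyl ℓ) := ⟨⟨diamondOrigin, diamondOrigin_mem_diamondCyl ℓ⟩⟩
  refine ⟨fun x y => ?_⟩
  have hx := diamondCyl_reachable_origin hℓ (normSq (x.1 : Site 3)).toNat x.1 x.2 (Int.self_le_toNat _)
  have hy := diamondCyl_reachable_origin hℓ (normSq (y.1 : Site 3)).toNat y.1 y.2 (Int.self_le_toNat _)
  exact hx.trans hy.symm

/-- Every diamond site lies in the cylinder of half-width `|x₀| + |x₁| + 1`. [folklore] -/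
theorem mem_diamondCyl_natAbs (x : diamondSite) :
    x ∈ diamondCyl (((x : Site 3) 0).natAbs + ((x : Site 3) 1).natAbs + 1) := by
  have hu := two_mul_diamondSkel_zero x
  have hv := two_mul_diamondSkel_one x
  have ha0 := le_abs_self ((x : Site 3) 0)
  have ha0' := neg_abs_le ((x : Site 3) 0)
  have ha1 := le_abs_self ((x : Site 3) 1)
  have ha1' := neg_abs_le ((x : Site 3) 1)
  rw [mem_diamondCyl_iff, mem_box]
  intro i
  push_cast
  rcases (show i = 0 ∨ i = 1 by fin_cases i <;> simp) with rfl | rfl <;> omega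

/-- **Every diamond site is joined to the origin.** [folklore] -/
theorem diamond_reachable_origin (x : diamondSite) : diamondGraph.Reachable x diamondOrigin := by
  set ℓ : ℕ := ((x : Site 3) 0).natAbs + ((x : Site 3) 1).natAbs + 1 with hℓ
  have h1 : 1 ≤ ℓ := by rw [hℓ]; omega
  have h := diamondCyl_reachable_origin h1 (normSq (x : Site 3)).toNat x (mem_diamondCyl_natAbs x) (Int.self_le_toNat _)
  exact h.map (Embedding.induce (diamondCyl ℓ)).toHom

/-- **The diamond lattice is connected.** [cite: ConwaySloane1999, Ch. 4 §7.3] -/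
theorem diamondGraph_connected : diamondGraph.Connected := by
  haveI : Nonempty diamondSite := ⟨diamondOrigin⟩
  exact ⟨fun x y => (diamond_reachable_origin x).trans (diamond_reachable_origin y).symm⟩

end Summit.CriticalPhenomena.PercolationContinuityZ3.Theorems.Transplant

end
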